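import Literature.Barriers.AtomisticToContinuum.HardDiskAuxLipschitz
import HarnessLib

/-!
# Lemma 16 (6.2) of Richthammer 2007: the translation distance functions are `1/2`-Lipschitz
# along `e₁`

Sequel to `HardDiskAuxLipschitz.lean` (provefact `Richthammer2007_ineq35`): the field `lipschitz`
of `ShearCells.Admissible` for the concrete translation systems `richtShift` of
`HardDiskDeformation.lean`. "`t^k_{n,X}` is the minimum of finitely many functions of the form
`τ_n(|.|) ∧ m_{x',t}`, where `x' ∈ ℝ²` and `t ∈ ℝ`. Hence (6.2) is an immediate consequence of
Lemmas 15 and 14" [Richthammer2007, §6.3, p. 13]. In coordinates the `k`-th function also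
contains the infimum over the (possibly infinitely many) points of the boundary condition outside
`Λ_n` (`m_{p⁰,τ⁰}`); the infimum of any family of `1/2`-Lipschitz functions bounded below is
`1/2`-Lipschitz, so the argument is the same. Proved here:

* `listShift_eq_biInf`, `stageShift_eq_ciInf` — `t^k(y)` is the real infimum of the family
  `τ_n(|y|)`, `(τ_n(|·|) ∧ m_{x,0})(y)` (`x ∈ X̄_{Λ_nᶜ}`), `(τ_n(|·|) ∧ m_{pⁱ,τⁱ})(y)`;
* `lipschitz_stageShift_line` — (6.2): `r ↦ t^k(y₀ + r e₁)` is `1/2`-Lipschitz;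
* `richtShift_update` — moving particle `l` does not change the earlier pairs, and
  **`lipschitz_richtShift`** — the translation system is `1/2`-Lipschitz along `e₁` in each
  particle (for `ε > 0`, `0 ≤ τ ≤ 1/2`, `R + 1 ≤ n`).

## References

* [Richthammer2007] T. Richthammer, *Translation-invariance of two-dimensional Gibbsian point
  processes*, Comm. Math. Phys. 274 (2007) 81–122, arXiv:0706.3637: §6.3 Lemma 16 (6.2)
  (p. 13), §6.2 Lemmas 14–15 (p. 13).
-/

noncomputable section

open MeasureTheory Set Function Filter
open scoped ENNReal NNReal Topology

namespace Literature.Barriers.AtomisticToContinuum.HardDisk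

open Literature.Analysis.FunctionSpaces

/-- A lattice identity: `a ⊓ ⨅ f = a ⊓ ⨅ (a ⊓ f i)`. [folklore] -/
theorem inf_iInf_eq_inf_iInf_inf {α ι : Type*} [CompleteLattice α] (a : α) (f : ι → α) :
    a ⊓ ⨅ i, f i = a ⊓ ⨅ i, (a ⊓ f i) := by
  apply le_antisymm
  · exact le_inf inf_le_left (le_iInf fun i => le_inf inf_le_left (inf_le_right.trans (iInf_le f i)))
  · exact le_inf inf_le_left (le_iInf fun i => inf_le_right.trans ((iInf_le _ i).trans inf_le_right))

namespace DeformData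

variable {P : DeformData}

/-! ### `t^k` as an infimum of capped terms -/

variable (P) in
/-- The constraints of a list as a bounded infimum over its members. [folklore] -/
theorem listShift_eq_biInf (E : List (EuclideanSpace ℝ (Fin 2) × ℝ)) (y : EuclideanSpace ℝ (Fin 2)) :
    P.listShift E y = ⨅ pt ∈ {pt | pt ∈ E}, P.mAux pt.1 pt.2 y := by
  induction E with
  | nil => simp [listShift]
  | cons a l ih =>
    have hset : {pt : EuclideanSpace ℝ (Fin 2) × ℝ | pt ∈ a :: l} = insert a {pt | pt ∈ l} := by
      ext pt; simp
    simp only [listShift, List.map_cons, List.foldr_cons] at ih ⊢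
    rw [hset, iInf_insert, ← ih]

/-- **`t^k(y)` as a real infimum**: for a boundary condition `Y`, earlier pairs `E` with
nonnegative `τⁱ`, and a point `y`,
`t^k(y) = inf {τ_n(|y|)} ∪ {(τ_n ∧ m_{x,0})(y) : x ∈ Y_{Λ_nᶜ}} ∪ {(τ_n ∧ m_{pⁱ,τⁱ})(y)}`.
[cite: Richthammer2007, §5.4 (p. 11) and §6.3 (p. 13)] -/
theorem stageShift_eq_ciInf (hτ : 0 ≤ P.τ) (hRn : P.R < P.n) (Y : PointConfig (EuclideanSpace ℝ (Fin 2)))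
    {E : List (EuclideanSpace ℝ (Fin 2) × ℝ)} (hE : ∀ pt ∈ E, 0 ≤ pt.2) (y : EuclideanSpace ℝ (Fin 2)) :
    P.stageShift Y E y =
      ⨅ o : Option ({q : EuclideanSpace ℝ (Fin 2) // q ∈ Y ∧ q ∉ box (P.n : ℝ)} ⊕ {pt // pt ∈ E}),
        o.elim (P.baseShift y) (Sum.elim (fun q => P.capAux q.1 0 y) (fun p => P.capAux p.1.1 p.1.2 y)) := by
  -- the `EReal` infimum defining `stageShift` is the infimum of the capped terms
  set G : Option ({q : EuclideanSpace ℝ (Fin 2) // q ∈ Y ∧ q ∉ box (P.n : ℝ)} ⊕ {pt // pt ∈ E}) → ℝ :=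
    fun o => o.elim (P.baseShift y) (Sum.elim (fun q => P.capAux q.1 0 y) (fun p => P.capAux p.1.1 p.1.2 y))
    with hG
  have hG0 : ∀ o, 0 ≤ G o := by
    rintro (_ | (q | p))
    · exact (baseShift_mem_Icc hτ hRn y).1
    · exact capAux_nonneg hτ hRn _ le_rfl _
    · exact capAux_nonneg hτ hRn _ (hE _ p.2) _
  have hbdd : BddBelow (Set.range G) := ⟨0, by rintro _ ⟨o, rfl⟩; exact hG0 o⟩
  have key : (P.baseShift y : EReal) ⊓ P.outShift Y y ⊓ P.listShift E y = ⨅ o, (G o : EReal) := by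
    rw [iInf_option, iInf_sum]
    simp only [hG, Option.elim, Sum.elim_inl, Sum.elim_inr]
    -- outside points
    have hout : (P.baseShift y : EReal) ⊓ P.outShift Y y =
        (P.baseShift y : EReal) ⊓ ⨅ q : {q : EuclideanSpace ℝ (Fin 2) // q ∈ Y ∧ q ∉ box (P.n : ℝ)},
          (P.capAux q.1 0 y : EReal) := by
      unfold outShift
      rw [inf_iInf_eq_inf_iInf_inf]
      simp only [coe_capAux]
    -- list points
    have hlist : (P.baseShift y : EReal) ⊓ P.listShift E y =
        (P.baseShift y : EReal) ⊓ ⨅ p : {pt // pt ∈ E}, (P.capAux p.1.1 p.1.2 y : EReal) := by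
      rw [listShift_eq_biInf, iInf_subtype', inf_iInf_eq_inf_iInf_inf]
      simp only [coe_capAux]
      rfl
    calc (P.baseShift y : EReal) ⊓ P.outShift Y y ⊓ P.listShift E y
        = ((P.baseShift y : EReal) ⊓ P.outShift Y y) ⊓ ((P.baseShift y : EReal) ⊓ P.listShift E y) := by
          rw [inf_inf_inf_comm, inf_idem, inf_assoc]
      _ = _ := by
          rw [hout, hlist, inf_inf_inf_comm, inf_idem]
  rw [stageShift, key, iInf_coe_eq_coe_ciInf hbdd, EReal.toReal_coe]

/-! ### (6.2): `t^k` is `1/2`-Lipschitz along `e₁` -/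

/-- **Lemma 16 (6.2) (Lipschitz half).** For `ε > 0`, `0 ≤ τ ≤ 1/2`, `R + 1 ≤ n`, a boundary
condition `Y`, earlier pairs with nonnegative `τⁱ` and a base point `y₀`, the function
`r ↦ t^k(y₀ + r e₁)` is `1/2`-Lipschitz (an infimum of `1/2`-Lipschitz functions bounded below,
Lemmas 14 (a) and 15). [cite: Richthammer2007, §6.3 Lemma 16 (6.2) (p. 13)] -/
theorem lipschitz_stageShift_line (hε : 0 < P.ε) (hτ : 0 ≤ P.τ) (hτ2 : P.τ ≤ 1 / 2)
    (hRn : P.R + 1 ≤ P.n) (Y : PointConfig (EuclideanSpace ℝ (Fin 2)))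
    {E : List (EuclideanSpace ℝ (Fin 2) × ℝ)} (hE : ∀ pt ∈ E, 0 ≤ pt.2) (y₀ : EuclideanSpace ℝ (Fin 2)) :
    LipschitzWith (1 / 2 : ℝ≥0) fun r : ℝ =>
      P.stageShift Y E (y₀ + r • EuclideanSpace.single (0 : Fin 2) (1 : ℝ)) := by
  have hRn0 : P.R < P.n := Nat.lt_of_succ_le hRn
  -- the family of capped terms along the line
  set G : Option ({q : EuclideanSpace ℝ (Fin 2) // q ∈ Y ∧ q ∉ box (P.n : ℝ)} ⊕ {pt // pt ∈ E}) → ℝ → ℝ :=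
    fun o r => o.elim (P.baseShift (y₀ + r • EuclideanSpace.single (0 : Fin 2) (1 : ℝ)))
      (Sum.elim (fun q => P.capAux q.1 0 (y₀ + r • EuclideanSpace.single (0 : Fin 2) (1 : ℝ)))
        (fun p => P.capAux p.1.1 p.1.2 (y₀ + r • EuclideanSpace.single (0 : Fin 2) (1 : ℝ))))
    with hG
  have hG0 : ∀ o r, 0 ≤ G o r := by
    rintro (_ | (q | p)) r
    · exact (baseShift_mem_Icc hτ hRn0 _).1
    · exact capAux_nonneg hτ hRn0 _ le_rfl _
    · exact capAux_nonneg hτ hRn0 _ (hE _ p.2) _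
  have hbdd : ∀ r, BddBelow (Set.range fun o => G o r) := fun r =>
    ⟨0, by rintro _ ⟨o, rfl⟩; exact hG0 o r⟩
  have hGlip : ∀ o, LipschitzWith (1 / 2 : ℝ≥0) (G o) := by
    rintro (_ | (q | p))
    · exact lipschitz_baseShift_line hτ hτ2 hRn y₀
    · exact lipschitz_capAux_line hε hτ hτ2 hRn q.1 0 y₀
    · exact lipschitz_capAux_line hε hτ hτ2 hRn p.1.1 p.1.2 y₀
  have heq : ∀ r, P.stageShift Y E (y₀ + r • EuclideanSpace.single (0 : Fin 2) (1 : ℝ)) = ⨅ o, G o r :=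
    fun r => stageShift_eq_ciInf hτ hRn0 Y hE _
  refine LipschitzWith.of_dist_le_mul fun r r' => ?_
  rw [Real.dist_eq, Real.dist_eq, heq, heq]
  refine abs_ciInf_sub_ciInf_le (hbdd r) (hbdd r') fun o => ?_
  have h := (hGlip o).dist_le_mul r r'
  rwa [Real.dist_eq, Real.dist_eq] at h

/-! ### The translation system along `e₁` in one particle -/

/-- **Moving particle `l` does not change the earlier pairs**: the translation of particle `l`
at the displaced configuration is `t^k` (computed from the undisplaced earlier particles)
evaluated at the displaced position. [cite: Richthammer2007, §6.6 (p. 16)] -/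
theorem richtShift_update (Y : PointConfig (EuclideanSpace ℝ (Fin 2))) (k : ℕ) (π : Equiv.Perm (Fin k))
    (l : Fin k) (x : Fin k → EuclideanSpace ℝ (Fin 2)) (v : EuclideanSpace ℝ (Fin 2)) :
    P.richtShift Y k π l (update x l v) =
      P.stageShift Y (P.stagePairs Y (posSeq π x) (stageOf π l)) v := by
  unfold richtShift
  rw [update_self]
  congr 1
  refine stagePairs_congr (P := P) Y fun i hi => ?_
  unfold posSeq
  split_ifs with hik
  · rw [update_of_ne]
    intro h
    -- `π (rev i) = l` forces `i = stageOf π l`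
    have : i = stageOf π l := by
      unfold stageOf
      have h' : Fin.rev ⟨i, hik⟩ = π.symm l := by rw [← h, Equiv.symm_apply_apply]
      rw [← h', Fin.rev_rev]
    exact absurd this (ne_of_lt hi)
  · rfl

/-- **The translation system is `1/2`-Lipschitz along `e₁` in each particle** (the field
`lipschitz` of `ShearCells.Admissible` for `richtShift`; `ε > 0`, `0 ≤ τ ≤ 1/2`, `R + 1 ≤ n`).
[cite: Richthammer2007, §6.3 Lemma 16 (6.2) (p. 13)] -/
theorem lipschitz_richtShift (hε : 0 < P.ε) (hτ : 0 ≤ P.τ) (hτ2 : P.τ ≤ 1 / 2) (hRn : P.R + 1 ≤ P.n)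
    (Y : PointConfig (EuclideanSpace ℝ (Fin 2))) (k : ℕ) (π : Equiv.Perm (Fin k)) (l : Fin k)
    (x : Fin k → EuclideanSpace ℝ (Fin 2)) :
    LipschitzWith (1 / 2 : ℝ≥0) fun r : ℝ =>
      P.richtShift Y k π l (update x l (x l + r • EuclideanSpace.single (0 : Fin 2) (1 : ℝ))) := by
  have hRn0 : P.R < P.n := Nat.lt_of_succ_le hRn
  simp only [richtShift_update]
  exact lipschitz_stageShift_line hε hτ hτ2 hRn Y (stagePairs_nonneg hτ hRn0 Y _ _) (x l)

end DeformData

end Literature.Barriers.AtomisticToContinuum.HardDisk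

end
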